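import Literature.AlgebraicGeometry.Motives.FamiliesVHSTensorMorphism
import Literature.AlgebraicGeometry.Motives.FamiliesVHSProdMorphism
import HarnessLib

/-!
# Distributivity of `⊗` over `⊕` for VHS data: `(D₁ ⊕ D₂) ⊗ D₃ ≅ (D₁ ⊗ D₃) ⊕ (D₂ ⊗ D₃)` and `D₁ ⊗ (D₂ ⊕ D₃) ≅ (D₁ ⊗ D₂) ⊕ (D₁ ⊗ D₃)`, and the Hodge classes of `(V₁ ⊕ V₂) ⊗ V₃`

Topic `Literature/AlgebraicGeometry/Motives` (namespace `Literature.AlgebraicGeometry.Motives.VHSData`), lane `lit-hodgefound` (seat `p08`, row g57-#8).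
DEFINITIONS WITH BODIES (the mutually inverse morphisms `Hom.prodTensorDistrib ∕ prodTensorDistribSymm`, `Hom.tensorProdDistrib ∕ tensorProdDistribSymm`)
and their API; no named fact, no instance, no notation (D-0026 net debt `0`).  Everything is ASSEMBLED from the biproduct calculus of
`Motives/FamiliesVHSProdMorphism` (`fst`, `snd`, `inl`, `inr`, `prodLift`, `coprodDesc`) and the functoriality `φ ⊗ ψ` of `Motives/FamiliesVHSTensorMorphism`:
`⊗` is additive in each variable, so it distributes over the biproduct (Deligne–Milne: in an additive tensor category `⊗` is bi-additive).

PRINTED SOURCES.  P. Deligne, J. Milne, *Tannakian categories*, LNM 900 (1982), §1, 1.15–1.16 («additive tensor category … `⊗` is bi-additive»; abelian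
tensor categories).  P. Deligne, *Théorie de Hodge II*, 2.1 (the category of Hodge structures is abelian; direct sums) and 1.1.12 (`⊗`).  P. Deligne,
*Équations différentielles à points singuliers réguliers*, LNM 163 (1970), I.1 (local systems: `⊕`, `⊗` fibrewise).  C. Voisin, *Hodge theory and complex
algebraic geometry I*, §7.3.1 (morphisms of variations; Hodge classes are functorial).

* §0 linear algebra over a commutative ring (private): the two composites of `(x₁, x₂) ⊗ y ↦ (x₁ ⊗ y, x₂ ⊗ y)` and `(a, b) ↦ (ι₁ ⊗ 1) a + (ι₂ ⊗ 1) b` are the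
  identities, and the mirror statements.
* §1 **`Hom.prodTensorDistrib D₁ D₂ D₃ : (D₁ ⊕ D₂) ⊗ D₃ → (D₁ ⊗ D₃) ⊕ (D₂ ⊗ D₃)`** `:= prodLift (fst ⊗ id) (snd ⊗ id)` and
  **`Hom.prodTensorDistribSymm := coprodDesc (inl ⊗ id) (inr ⊗ id)`**, their values, and the two identities `Symm ∘ Distrib = id`, `Distrib ∘ Symm = id`.
* §2 the mirror **`Hom.tensorProdDistrib D₁ D₂ D₃ : D₁ ⊗ (D₂ ⊕ D₃) → (D₁ ⊗ D₂) ⊕ (D₁ ⊗ D₃)`** and `Hom.tensorProdDistribSymm`, same API.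
* §3 **Hodge classes of `(V₁ ⊕ V₂) ⊗ V₃`**: an integral class `z` is Hodge of level `p` iff its two components `(pr₁ ⊗ 1) z ∈ V₁ ⊗ V₃` and
  `(pr₂ ⊗ 1) z ∈ V₂ ⊗ V₃` are (`isHodgeAt_prod_tensor_iff`); mirror `isHodgeAt_tensor_prod_iff`; transported forms for the Hodge loci.

HONEST SCOPE: as for every `VHSData`, holomorphy ∕ transversality are not recorded.

## References

* [DeligneMilne1982Tannakian] P. Deligne, J. S. Milne, *Tannakian categories*, in LNM 900 (1982), §1, 1.15–1.16.
* [DeligneHodgeII1971] P. Deligne, *Théorie de Hodge II*, Publ. Math. IHÉS 40 (1971), 1.1.12, 2.1.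
* [Deligne1970] P. Deligne, *Équations différentielles à points singuliers réguliers*, LNM 163 (1970), I.1.
* [VoisinHodgeI2002] C. Voisin, *Hodge Theory and Complex Algebraic Geometry I*, CUP 2002, §7.3.1.
-/

noncomputable section

open CategoryTheory
open scoped TensorProduct

namespace Literature.AlgebraicGeometry.Motives

namespace VHSData

variable {S : Type} [TopologicalSpace S] {k k₁ k₃ : ℤ}

/-! ## §0 Linear algebra: `⊗` distributes over `×` -/

section LinearAlgebra

variable {R : Type*} [CommRing R] {M N P : Type*} [AddCommGroup M] [Module R M] [AddCommGroup N] [Module R N] [AddCommGroup P] [Module R P]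

/-- `(ι₁ ⊗ 1)(pr₁ ⊗ 1) z + (ι₂ ⊗ 1)(pr₂ ⊗ 1) z = z` on `(M × N) ⊗ P`. [folklore] -/
private theorem inl_fst_add_inr_snd_rTensor (z : (M × N) ⊗[R] P) :
    TensorProduct.map (LinearMap.inl R M N) LinearMap.id (TensorProduct.map (LinearMap.fst R M N) (LinearMap.id (M := P)) z) +
      TensorProduct.map (LinearMap.inr R M N) LinearMap.id (TensorProduct.map (LinearMap.snd R M N) (LinearMap.id (M := P)) z) = z := by
  induction z using TensorProduct.induction_on with
  | zero => rw [map_zero, map_zero, map_zero, map_zero, add_zero]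
  | tmul x y =>
    rw [TensorProduct.map_tmul, TensorProduct.map_tmul, TensorProduct.map_tmul, TensorProduct.map_tmul, ← TensorProduct.add_tmul]
    exact congrArg (· ⊗ₜ[R] (LinearMap.id y)) (Prod.ext (add_zero x.1) (zero_add x.2))
  | add z w hz hw => rw [map_add, map_add, map_add, map_add, add_add_add_comm, hz, hw]

/-- `(pr₁ ⊗ 1)((ι₁ ⊗ 1) a + (ι₂ ⊗ 1) b) = a` on `(M ⊗ P) × (N ⊗ P)`. [folklore] -/
private theorem fst_rTensor_inl_add_inr (a : M ⊗[R] P) (b : N ⊗[R] P) :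
    TensorProduct.map (LinearMap.fst R M N) LinearMap.id
        (TensorProduct.map (LinearMap.inl R M N) (LinearMap.id (M := P)) a + TensorProduct.map (LinearMap.inr R M N) (LinearMap.id (M := P)) b) = a := by
  rw [map_add, TensorProduct.map_map, TensorProduct.map_map, LinearMap.fst_comp_inl, LinearMap.fst_comp_inr, LinearMap.comp_id,
    TensorProduct.map_id, TensorProduct.map_zero_left, LinearMap.id_apply, LinearMap.zero_apply, add_zero]

/-- `(pr₂ ⊗ 1)((ι₁ ⊗ 1) a + (ι₂ ⊗ 1) b) = b`. [folklore] -/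
private theorem snd_rTensor_inl_add_inr (a : M ⊗[R] P) (b : N ⊗[R] P) :
    TensorProduct.map (LinearMap.snd R M N) LinearMap.id
        (TensorProduct.map (LinearMap.inl R M N) (LinearMap.id (M := P)) a + TensorProduct.map (LinearMap.inr R M N) (LinearMap.id (M := P)) b) = b := by
  rw [map_add, TensorProduct.map_map, TensorProduct.map_map, LinearMap.snd_comp_inl, LinearMap.snd_comp_inr, LinearMap.comp_id,
    TensorProduct.map_id, TensorProduct.map_zero_left, LinearMap.id_apply, LinearMap.zero_apply, zero_add]

/-- `(1 ⊗ ι₁)(1 ⊗ pr₁) z + (1 ⊗ ι₂)(1 ⊗ pr₂) z = z` on `P ⊗ (M × N)`. [folklore] -/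
private theorem inl_fst_add_inr_snd_lTensor (z : P ⊗[R] (M × N)) :
    TensorProduct.map LinearMap.id (LinearMap.inl R M N) (TensorProduct.map (LinearMap.id (M := P)) (LinearMap.fst R M N) z) +
      TensorProduct.map LinearMap.id (LinearMap.inr R M N) (TensorProduct.map (LinearMap.id (M := P)) (LinearMap.snd R M N) z) = z := by
  induction z using TensorProduct.induction_on with
  | zero => rw [map_zero, map_zero, map_zero, map_zero, add_zero]
  | tmul y x =>
    rw [TensorProduct.map_tmul, TensorProduct.map_tmul, TensorProduct.map_tmul, TensorProduct.map_tmul, ← TensorProduct.tmul_add]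
    exact congrArg (LinearMap.id y ⊗ₜ[R] ·) (Prod.ext (add_zero x.1) (zero_add x.2))
  | add z w hz hw => rw [map_add, map_add, map_add, map_add, add_add_add_comm, hz, hw]

/-- `(1 ⊗ pr₁)((1 ⊗ ι₁) a + (1 ⊗ ι₂) b) = a` on `(P ⊗ M) × (P ⊗ N)`. [folklore] -/
private theorem fst_lTensor_inl_add_inr (a : P ⊗[R] M) (b : P ⊗[R] N) :
    TensorProduct.map LinearMap.id (LinearMap.fst R M N)
        (TensorProduct.map (LinearMap.id (M := P)) (LinearMap.inl R M N) a + TensorProduct.map (LinearMap.id (M := P)) (LinearMap.inr R M N) b) = a := by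
  rw [map_add, TensorProduct.map_map, TensorProduct.map_map, LinearMap.fst_comp_inl, LinearMap.fst_comp_inr, LinearMap.comp_id,
    TensorProduct.map_id, TensorProduct.map_zero_right, LinearMap.id_apply, LinearMap.zero_apply, add_zero]

/-- `(1 ⊗ pr₂)((1 ⊗ ι₁) a + (1 ⊗ ι₂) b) = b`. [folklore] -/
private theorem snd_lTensor_inl_add_inr (a : P ⊗[R] M) (b : P ⊗[R] N) :
    TensorProduct.map LinearMap.id (LinearMap.snd R M N)
        (TensorProduct.map (LinearMap.id (M := P)) (LinearMap.inl R M N) a + TensorProduct.map (LinearMap.id (M := P)) (LinearMap.inr R M N) b) = b := by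
  rw [map_add, TensorProduct.map_map, TensorProduct.map_map, LinearMap.snd_comp_inl, LinearMap.snd_comp_inr, LinearMap.comp_id,
    TensorProduct.map_id, TensorProduct.map_zero_right, LinearMap.id_apply, LinearMap.zero_apply, zero_add]

end LinearAlgebra

/-! ## §1 `(D₁ ⊕ D₂) ⊗ D₃ ≅ (D₁ ⊗ D₃) ⊕ (D₂ ⊗ D₃)` -/

section ProdTensor

variable (D₁ D₂ : VHSData S k) (D₃ : VHSData S k₃)

/-- **`(D₁ ⊕ D₂) ⊗ D₃ → (D₁ ⊗ D₃) ⊕ (D₂ ⊗ D₃)`**, `:= prodLift (pr₁ ⊗ id) (pr₂ ⊗ id)`: a morphism of VHS data (flat, Hodge fibrewise) because it is assembled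
from morphisms; on lattices `(u₁, u₂) ⊗ u₃ ↦ (u₁ ⊗ u₃, u₂ ⊗ u₃)`. [cite: DeligneMilne1982Tannakian, §1, 1.15–1.16] [cite: DeligneHodgeII1971, 1.1.12 and 2.1]
[cite: Deligne1970, I.1] -/
def Hom.prodTensorDistrib : Hom ((D₁.prod D₂).tensor D₃) ((D₁.tensor D₃).prod (D₂.tensor D₃)) :=
  ((Hom.fst D₁ D₂).tensor (Hom.id D₃)).prodLift ((Hom.snd D₁ D₂).tensor (Hom.id D₃))

/-- **`(D₁ ⊗ D₃) ⊕ (D₂ ⊗ D₃) → (D₁ ⊕ D₂) ⊗ D₃`**, `:= coprodDesc (ι₁ ⊗ id) (ι₂ ⊗ id)`; on lattices `(a, b) ↦ (ι₁ ⊗ 1) a + (ι₂ ⊗ 1) b`.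
[cite: DeligneMilne1982Tannakian, §1, 1.15–1.16] [cite: DeligneHodgeII1971, 1.1.12 and 2.1] [cite: Deligne1970, I.1] -/
def Hom.prodTensorDistribSymm : Hom ((D₁.tensor D₃).prod (D₂.tensor D₃)) ((D₁.prod D₂).tensor D₃) :=
  ((Hom.inl D₁ D₂).tensor (Hom.id D₃)).coprodDesc ((Hom.inr D₁ D₂).tensor (Hom.id D₃))

/-- `prodTensorDistrib ((u₁, u₂) ⊗ u₃) = (u₁ ⊗ u₃, u₂ ⊗ u₃)`. [cite: Deligne1970, I.1] -/
theorem Hom.prodTensorDistrib_app_mk_tmul (s : S) (u₁ : D₁.VZ.fiber s) (u₂ : D₂.VZ.fiber s) (u₃ : D₃.VZ.fiber s) :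
    (Hom.prodTensorDistrib D₁ D₂ D₃).app s (((u₁, u₂) : D₁.VZ.fiber s × D₂.VZ.fiber s) ⊗ₜ[ℤ] u₃) =
      ((u₁ ⊗ₜ[ℤ] u₃, u₂ ⊗ₜ[ℤ] u₃) : (D₁.VZ.fiber s ⊗[ℤ] D₃.VZ.fiber s) × (D₂.VZ.fiber s ⊗[ℤ] D₃.VZ.fiber s)) := rfl

/-- `prodTensorDistribSymm (u₁ ⊗ u₃, 0) = (u₁, 0) ⊗ u₃` and similarly for the second summand: values on the two inclusions. [cite: Deligne1970, I.1] -/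
theorem Hom.prodTensorDistribSymm_app_inl_tmul (s : S) (u₁ : D₁.VZ.fiber s) (u₃ : D₃.VZ.fiber s) :
    (Hom.prodTensorDistribSymm D₁ D₂ D₃).app s ((Hom.inl (D₁.tensor D₃) (D₂.tensor D₃)).app s (u₁ ⊗ₜ[ℤ] u₃)) =
      (Hom.inl D₁ D₂).app s u₁ ⊗ₜ[ℤ] u₃ := by
  have h0 : TensorProduct.map ((Hom.inr D₁ D₂).app s) ((Hom.id D₃).app s) 0 = 0 := map_zero _
  exact (congrArg (fun w => (Hom.inl D₁ D₂).app s u₁ ⊗ₜ[ℤ] u₃ + w) h0).trans (_root_.add_zero _)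

/-- `prodTensorDistribSymm (0, u₂ ⊗ u₃) = (0, u₂) ⊗ u₃`. [cite: Deligne1970, I.1] -/
theorem Hom.prodTensorDistribSymm_app_inr_tmul (s : S) (u₂ : D₂.VZ.fiber s) (u₃ : D₃.VZ.fiber s) :
    (Hom.prodTensorDistribSymm D₁ D₂ D₃).app s ((Hom.inr (D₁.tensor D₃) (D₂.tensor D₃)).app s (u₂ ⊗ₜ[ℤ] u₃)) =
      (Hom.inr D₁ D₂).app s u₂ ⊗ₜ[ℤ] u₃ := by
  have h0 : TensorProduct.map ((Hom.inl D₁ D₂).app s) ((Hom.id D₃).app s) 0 = 0 := map_zero _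
  exact (congrArg (fun w => w + (Hom.inr D₁ D₂).app s u₂ ⊗ₜ[ℤ] u₃) h0).trans (_root_.zero_add _)

/-- **`prodTensorDistribSymm ∘ prodTensorDistrib = id`.** [cite: DeligneMilne1982Tannakian, §1, 1.15–1.16] -/
theorem Hom.prodTensorDistribSymm_comp_prodTensorDistrib :
    (Hom.prodTensorDistribSymm D₁ D₂ D₃).comp (Hom.prodTensorDistrib D₁ D₂ D₃) = Hom.id ((D₁.prod D₂).tensor D₃) :=
  Hom.ext_of_app _ _ fun _ => LinearMap.ext fun z => inl_fst_add_inr_snd_rTensor z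

/-- **`prodTensorDistrib ∘ prodTensorDistribSymm = id`.** [cite: DeligneMilne1982Tannakian, §1, 1.15–1.16] -/
theorem Hom.prodTensorDistrib_comp_prodTensorDistribSymm :
    (Hom.prodTensorDistrib D₁ D₂ D₃).comp (Hom.prodTensorDistribSymm D₁ D₂ D₃) = Hom.id ((D₁.tensor D₃).prod (D₂.tensor D₃)) :=
  Hom.ext_of_app _ _ fun _ => LinearMap.ext fun w => Prod.ext (fst_rTensor_inl_add_inr w.1 w.2) (snd_rTensor_inl_add_inr w.1 w.2)

/-- Pointwise: `prodTensorDistribSymm (prodTensorDistrib z) = z`. [cite: DeligneMilne1982Tannakian, §1, 1.15–1.16] -/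
theorem Hom.prodTensorDistribSymm_app_prodTensorDistrib_app (s : S) (z : ((D₁.prod D₂).tensor D₃).VZ.fiber s) :
    (Hom.prodTensorDistribSymm D₁ D₂ D₃).app s ((Hom.prodTensorDistrib D₁ D₂ D₃).app s z) = z :=
  inl_fst_add_inr_snd_rTensor z

/-- Pointwise: `prodTensorDistrib (prodTensorDistribSymm w) = w`. [cite: DeligneMilne1982Tannakian, §1, 1.15–1.16] -/
theorem Hom.prodTensorDistrib_app_prodTensorDistribSymm_app (s : S) (w : ((D₁.tensor D₃).prod (D₂.tensor D₃)).VZ.fiber s) :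
    (Hom.prodTensorDistrib D₁ D₂ D₃).app s ((Hom.prodTensorDistribSymm D₁ D₂ D₃).app s w) = w :=
  Prod.ext (fst_rTensor_inl_add_inr w.1 w.2) (snd_rTensor_inl_add_inr w.1 w.2)

/-! ## §3a Hodge classes of `(V₁ ⊕ V₂) ⊗ V₃` -/

/-- **An integral class `z ∈ ((V₁ ⊕ V₂) ⊗ V₃)_ℤ,s` is a Hodge class of level `p` iff its two components `(pr₁ ⊗ 1) z ∈ V₁ ⊗ V₃` and
`(pr₂ ⊗ 1) z ∈ V₂ ⊗ V₃` are** (the distributivity isomorphism and its inverse preserve Hodge classes; Hodge classes of a direct sum are the pairs of Hodge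
classes). [cite: DeligneHodgeII1971, 1.1.12 and 2.1] [cite: VoisinHodgeI2002, §7.3.1] -/
theorem isHodgeAt_prod_tensor_iff (s : S) (p : ℤ) (z : ((D₁.prod D₂).tensor D₃).VZ.fiber s) :
    ((D₁.prod D₂).tensor D₃).IsHodgeAt s p z ↔
      (D₁.tensor D₃).IsHodgeAt s p (((Hom.fst D₁ D₂).tensor (Hom.id D₃)).app s z) ∧
        (D₂.tensor D₃).IsHodgeAt s p (((Hom.snd D₁ D₂).tensor (Hom.id D₃)).app s z) := by
  have key : ((D₁.tensor D₃).prod (D₂.tensor D₃)).IsHodgeAt s p ((Hom.prodTensorDistrib D₁ D₂ D₃).app s z) ↔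
      (D₁.tensor D₃).IsHodgeAt s p (((Hom.fst D₁ D₂).tensor (Hom.id D₃)).app s z) ∧
        (D₂.tensor D₃).IsHodgeAt s p (((Hom.snd D₁ D₂).tensor (Hom.id D₃)).app s z) :=
    isHodgeAt_prodLift_app_iff _ _ _ _ s p z
  rw [← key]
  refine ⟨fun h => (Hom.prodTensorDistrib D₁ D₂ D₃).isHodgeAt_app h, fun h => ?_⟩
  have h' : ((D₁.prod D₂).tensor D₃).IsHodgeAt s p ((Hom.prodTensorDistribSymm D₁ D₂ D₃).app s ((Hom.prodTensorDistrib D₁ D₂ D₃).app s z)) :=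
    (Hom.prodTensorDistribSymm D₁ D₂ D₃).isHodgeAt_app h
  rwa [Hom.prodTensorDistribSymm_app_prodTensorDistrib_app] at h'

/-- Transported form: the determination `γ·z` at `t` is Hodge of level `p` iff the determinations of its two components are. [cite: VoisinHodgeI2002, §7.3.1] -/
theorem isHodgeAt_prod_tensor_transport_iff {s t : S} (γ : Path.Homotopic.Quotient s t) (p : ℤ) (z : ((D₁.prod D₂).tensor D₃).VZ.fiber s) :
    ((D₁.prod D₂).tensor D₃).IsHodgeAt t p (((D₁.prod D₂).tensor D₃).VZ.transport γ z) ↔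
      (D₁.tensor D₃).IsHodgeAt t p ((D₁.tensor D₃).VZ.transport γ (((Hom.fst D₁ D₂).tensor (Hom.id D₃)).app s z)) ∧
        (D₂.tensor D₃).IsHodgeAt t p ((D₂.tensor D₃).VZ.transport γ (((Hom.snd D₁ D₂).tensor (Hom.id D₃)).app s z)) := by
  rw [isHodgeAt_prod_tensor_iff, Hom.app_transport, Hom.app_transport]

end ProdTensor

/-! ## §2 `D₁ ⊗ (D₂ ⊕ D₃) ≅ (D₁ ⊗ D₂) ⊕ (D₁ ⊗ D₃)` -/

section TensorProd

variable (D₁ : VHSData S k₁) (D₂ D₃ : VHSData S k)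

/-- **`D₁ ⊗ (D₂ ⊕ D₃) → (D₁ ⊗ D₂) ⊕ (D₁ ⊗ D₃)`**, `:= prodLift (id ⊗ pr₁) (id ⊗ pr₂)`; on lattices `u₁ ⊗ (u₂, u₃) ↦ (u₁ ⊗ u₂, u₁ ⊗ u₃)`.
[cite: DeligneMilne1982Tannakian, §1, 1.15–1.16] [cite: DeligneHodgeII1971, 1.1.12 and 2.1] [cite: Deligne1970, I.1] -/
def Hom.tensorProdDistrib : Hom (D₁.tensor (D₂.prod D₃)) ((D₁.tensor D₂).prod (D₁.tensor D₃)) :=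
  ((Hom.id D₁).tensor (Hom.fst D₂ D₃)).prodLift ((Hom.id D₁).tensor (Hom.snd D₂ D₃))

/-- **`(D₁ ⊗ D₂) ⊕ (D₁ ⊗ D₃) → D₁ ⊗ (D₂ ⊕ D₃)`**, `:= coprodDesc (id ⊗ ι₁) (id ⊗ ι₂)`. [cite: DeligneMilne1982Tannakian, §1, 1.15–1.16]
[cite: DeligneHodgeII1971, 1.1.12 and 2.1] [cite: Deligne1970, I.1] -/
def Hom.tensorProdDistribSymm : Hom ((D₁.tensor D₂).prod (D₁.tensor D₃)) (D₁.tensor (D₂.prod D₃)) :=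
  ((Hom.id D₁).tensor (Hom.inl D₂ D₃)).coprodDesc ((Hom.id D₁).tensor (Hom.inr D₂ D₃))

/-- `tensorProdDistrib (u₁ ⊗ (u₂, u₃)) = (u₁ ⊗ u₂, u₁ ⊗ u₃)`. [cite: Deligne1970, I.1] -/
theorem Hom.tensorProdDistrib_app_tmul_mk (s : S) (u₁ : D₁.VZ.fiber s) (u₂ : D₂.VZ.fiber s) (u₃ : D₃.VZ.fiber s) :
    (Hom.tensorProdDistrib D₁ D₂ D₃).app s (u₁ ⊗ₜ[ℤ] ((u₂, u₃) : D₂.VZ.fiber s × D₃.VZ.fiber s)) =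
      ((u₁ ⊗ₜ[ℤ] u₂, u₁ ⊗ₜ[ℤ] u₃) : (D₁.VZ.fiber s ⊗[ℤ] D₂.VZ.fiber s) × (D₁.VZ.fiber s ⊗[ℤ] D₃.VZ.fiber s)) := rfl

/-- **`tensorProdDistribSymm ∘ tensorProdDistrib = id`.** [cite: DeligneMilne1982Tannakian, §1, 1.15–1.16] -/
theorem Hom.tensorProdDistribSymm_comp_tensorProdDistrib :
    (Hom.tensorProdDistribSymm D₁ D₂ D₃).comp (Hom.tensorProdDistrib D₁ D₂ D₃) = Hom.id (D₁.tensor (D₂.prod D₃)) :=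
  Hom.ext_of_app _ _ fun _ => LinearMap.ext fun z => inl_fst_add_inr_snd_lTensor z

/-- **`tensorProdDistrib ∘ tensorProdDistribSymm = id`.** [cite: DeligneMilne1982Tannakian, §1, 1.15–1.16] -/
theorem Hom.tensorProdDistrib_comp_tensorProdDistribSymm :
    (Hom.tensorProdDistrib D₁ D₂ D₃).comp (Hom.tensorProdDistribSymm D₁ D₂ D₃) = Hom.id ((D₁.tensor D₂).prod (D₁.tensor D₃)) :=
  Hom.ext_of_app _ _ fun _ => LinearMap.ext fun w => Prod.ext (fst_lTensor_inl_add_inr w.1 w.2) (snd_lTensor_inl_add_inr w.1 w.2)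

/-- Pointwise: `tensorProdDistribSymm (tensorProdDistrib z) = z`. [cite: DeligneMilne1982Tannakian, §1, 1.15–1.16] -/
theorem Hom.tensorProdDistribSymm_app_tensorProdDistrib_app (s : S) (z : (D₁.tensor (D₂.prod D₃)).VZ.fiber s) :
    (Hom.tensorProdDistribSymm D₁ D₂ D₃).app s ((Hom.tensorProdDistrib D₁ D₂ D₃).app s z) = z :=
  inl_fst_add_inr_snd_lTensor z

/-- Pointwise: `tensorProdDistrib (tensorProdDistribSymm w) = w`. [cite: DeligneMilne1982Tannakian, §1, 1.15–1.16] -/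
theorem Hom.tensorProdDistrib_app_tensorProdDistribSymm_app (s : S) (w : ((D₁.tensor D₂).prod (D₁.tensor D₃)).VZ.fiber s) :
    (Hom.tensorProdDistrib D₁ D₂ D₃).app s ((Hom.tensorProdDistribSymm D₁ D₂ D₃).app s w) = w :=
  Prod.ext (fst_lTensor_inl_add_inr w.1 w.2) (snd_lTensor_inl_add_inr w.1 w.2)

/-! ## §3b Hodge classes of `V₁ ⊗ (V₂ ⊕ V₃)` -/

/-- **An integral class `z ∈ (V₁ ⊗ (V₂ ⊕ V₃))_ℤ,s` is a Hodge class of level `p` iff its components `(1 ⊗ pr₁) z`, `(1 ⊗ pr₂) z` are.**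
[cite: DeligneHodgeII1971, 1.1.12 and 2.1] [cite: VoisinHodgeI2002, §7.3.1] -/
theorem isHodgeAt_tensor_prod_iff (s : S) (p : ℤ) (z : (D₁.tensor (D₂.prod D₃)).VZ.fiber s) :
    (D₁.tensor (D₂.prod D₃)).IsHodgeAt s p z ↔
      (D₁.tensor D₂).IsHodgeAt s p (((Hom.id D₁).tensor (Hom.fst D₂ D₃)).app s z) ∧
        (D₁.tensor D₃).IsHodgeAt s p (((Hom.id D₁).tensor (Hom.snd D₂ D₃)).app s z) := by
  have key : ((D₁.tensor D₂).prod (D₁.tensor D₃)).IsHodgeAt s p ((Hom.tensorProdDistrib D₁ D₂ D₃).app s z) ↔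
      (D₁.tensor D₂).IsHodgeAt s p (((Hom.id D₁).tensor (Hom.fst D₂ D₃)).app s z) ∧
        (D₁.tensor D₃).IsHodgeAt s p (((Hom.id D₁).tensor (Hom.snd D₂ D₃)).app s z) :=
    isHodgeAt_prodLift_app_iff _ _ _ _ s p z
  rw [← key]
  refine ⟨fun h => (Hom.tensorProdDistrib D₁ D₂ D₃).isHodgeAt_app h, fun h => ?_⟩
  have h' : (D₁.tensor (D₂.prod D₃)).IsHodgeAt s p ((Hom.tensorProdDistribSymm D₁ D₂ D₃).app s ((Hom.tensorProdDistrib D₁ D₂ D₃).app s z)) :=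
    (Hom.tensorProdDistribSymm D₁ D₂ D₃).isHodgeAt_app h
  rwa [Hom.tensorProdDistribSymm_app_tensorProdDistrib_app] at h'

/-- Transported form. [cite: VoisinHodgeI2002, §7.3.1] -/
theorem isHodgeAt_tensor_prod_transport_iff {s t : S} (γ : Path.Homotopic.Quotient s t) (p : ℤ) (z : (D₁.tensor (D₂.prod D₃)).VZ.fiber s) :
    (D₁.tensor (D₂.prod D₃)).IsHodgeAt t p ((D₁.tensor (D₂.prod D₃)).VZ.transport γ z) ↔
      (D₁.tensor D₂).IsHodgeAt t p ((D₁.tensor D₂).VZ.transport γ (((Hom.id D₁).tensor (Hom.fst D₂ D₃)).app s z)) ∧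
        (D₁.tensor D₃).IsHodgeAt t p ((D₁.tensor D₃).VZ.transport γ (((Hom.id D₁).tensor (Hom.snd D₂ D₃)).app s z)) := by
  rw [isHodgeAt_tensor_prod_iff, Hom.app_transport, Hom.app_transport]

end TensorProd

end VHSData

end Literature.AlgebraicGeometry.Motives

end
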